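import Literature.NumberTheory.EllipticCurves.BSDSelmerPConverseSerreProofs
import Literature.NumberTheory.GaloisRepresentations.SL2TransvectionLifting
import HarnessLib

/-!
# Surjectivity of `ρ̄_{E,p}` plus one unipotent element lifts to surjectivity of `ρ̄_{E,p^n}`,
# for every prime `p`

Family `bsd`, companion to `Literature.NumberTheory.EllipticCurves.BSDSelmerPConverse` (bsd.S25)
and `Literature.NumberTheory.EllipticCurves.BSDSelmerPConverseSerreProofs`. The latter proves
Serre's lifting `serre_hasSurjectiveModNGaloisRep_pow_holds` — `ρ̄_{E,p}` onto ⟹ `ρ̄_{E,p^n}`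
onto — for `p ≥ 5` only, as it must (N. Elkies, arXiv:math/0612734: curves with `ρ̄_{E,3}` onto
and `ρ̄_{E,9}` not onto). This file proves the variant valid for **every prime** `p` which the
hypothesis (ram) of Burungale–Skinner–Tian–Wan, arXiv:2409.01350, Thm. 1.10 (tree fact
`Literature.NumberTheory.EllipticCurves.burungaleSkinnerTianWan_analyticRank_eq_one_of_selmerCorank_eq_one`)
is designed to feed:

* `hasSurjectiveModNGaloisRep_pow_of_unipotent` — for an elliptic curve `W/ℚ`, a prime `p` and
  `n : ℕ`: if `ρ̄_{E,p} : Γ_ℚ → Aut(E[p])` is onto and some `σ ∈ Γ_ℚ` acts on `E[p^n]`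
  unipotently, `(σ - 1)² = 0`, and non-trivially on `E[p] ⊆ E[p^n]`, then
  `ρ̄_{E,p^n} : Γ_ℚ → Aut(E[p^n])` is onto.

In the application `σ` is an element of the inertia group at a prime `ℓ ≠ p` of multiplicative
reduction at which `ρ̄_{E,p}` is ramified: by the theory of the Tate curve the inertia group at
`ℓ` acts on `E[p^n]` through `(1 *; 0 1)` (Silverman, *ATAEC*, V.4–V.5; Serre, *Propriétés
galoisiennes*, Invent. Math. 15 (1972), §1.12 and Appendix A.1), and "ramified at `ℓ`" says
`* ≢ 0 (mod p)` for some element.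

## Proof

Frame `E[p^n] ≅ (ℤ/p^n)²` (`nonempty_addEquiv_geomTorsion`) and let `ρ : Γ_ℚ → GL₂(ℤ/p^n)` be
the matrix representation (`exists_rep_of_addEquiv`), `H` its image. Then: `H` maps onto
`GL₂(𝔽_p)` (`exists_map_eq_of_hasSurjectiveModNGaloisRep`); `det H = (ℤ/p^n)ˣ` since
`det ρ = χ_{p^n}` (Weil pairing, `det_eq_modNCyclotomicCharacter`) is onto over `ℚ`
(`modNCyclotomicCharacter_rat_surjective`); and `u = ρ(σ)` satisfies `(u - 1)² = 0` (evaluate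
on vectors) and `u ≢ 1 (mod p)` (if `u - 1 = p C` then `σ Q - Q ↦ C (p Q) = 0` for `p Q = 0`).
Hence `H = GL₂(ℤ/p^n)` by the transvection form of Serre's lifting lemma, valid for all `p`
(`TransvectionLifting.generalLinearGroup_eq_top_of_unipotent_mem`,
`Literature/NumberTheory/GaloisRepresentations/SL2TransvectionLifting.lean`), and every additive
automorphism of `E[p^n]`, having an invertible matrix, is some `ρ̄_{E,p^n}(τ)`.

## Design notes

* Theorems only; the framing lemmas of `BSDSelmerPConverseSerreProofs` are reused, not restated.
* The unipotence hypotheses are stated inside the single type `geomTorsion W (p^n)`: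
  `σ • (σ • P - P) = σ • P - P` for all `P`, and `σ • Q ≠ Q` for some `Q` with `p • Q = 0`.

## References

* [SerreAbelianLadic1968] J.-P. Serre, *Abelian `ℓ`-adic representations and elliptic curves*
  (1968), Ch. IV §3.4, Lemma 3.
* [Serre1972] J.-P. Serre, *Propriétés galoisiennes des points d'ordre fini des courbes
  elliptiques*, Invent. Math. 15 (1972), 259–331, §1.12 and Appendix (Tate curves).
* [SilvermanCSS1997] J. H. Silverman, in Cornell–Silverman–Stevens (1997), Ch. II §7–§8
  (`det ρ̄_m = χ_m`).
-/

noncomputable section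

open scoped Classical MatrixGroups

open WeierstrassCurve Matrix

universe u

namespace Literature.NumberTheory.EllipticCurves

/-- **`ρ̄_{E,p}` onto and one unipotent element non-trivial modulo `p` ⟹ `ρ̄_{E,p^n}` onto, for
every prime `p`.** For an elliptic curve `W/ℚ`, a prime `p` and `n : ℕ`, suppose that the mod-`p`
representation `Γ_ℚ → Aut(E[p])` is onto (`WeierstrassCurve.HasSurjectiveModNGaloisRep W p`) and
that some `σ ∈ Γ_ℚ` acts on `E[p^n]` with `(σ - 1)² = 0` (i.e. `σ` fixes every `σ P - P`) and
moves some `Q ∈ E[p^n]` with `p Q = 0`. Then `Γ_ℚ → Aut(E[p^n])` is onto. Proof in the module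
docstring: frame, `det = χ_{p^n}` onto, and the transvection form of Serre's lifting lemma
(`TransvectionLifting.generalLinearGroup_eq_top_of_unipotent_mem`), which needs no hypothesis
on `p`. [cite: SerreAbelianLadic1968, Ch. IV §3.4, Lemma 3 (steps of the proof)] -/
theorem hasSurjectiveModNGaloisRep_pow_of_unipotent (W : WeierstrassCurve ℚ) [W.IsElliptic]
    (p : ℕ) [Fact p.Prime] (hsurj : W.HasSurjectiveModNGaloisRep p) (n : ℕ)
    (hu : ∃ σ : Field.absoluteGaloisGroup ℚ,
      (∀ P : geomTorsion W ((p ^ n : ℕ) : ℤ), σ • (σ • P - P) = σ • P - P) ∧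
        ∃ Q : geomTorsion W ((p ^ n : ℕ) : ℤ), p • Q = 0 ∧ σ • Q ≠ Q) :
    W.HasSurjectiveModNGaloisRep (p ^ n : ℕ) := by
  have hp : p.Prime := Fact.out
  obtain ⟨σ, hU, Q, hpQ, hσQ⟩ := hu
  cases n with
  | zero =>
    exfalso
    apply hσQ
    have ha := AddSubgroup.torsionBy.nsmul_iff.mp Q.2
    have hb := AddSubgroup.torsionBy.nsmul_iff.mp (σ • Q).2
    simp only [pow_zero, one_smul] at ha hb
    exact Subtype.ext (hb.trans ha.symm)
  | succ k =>
    have hpQ' : (p : ℚ) ≠ 0 := Nat.cast_ne_zero.mpr hp.ne_zero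
    obtain ⟨e⟩ := nonempty_addEquiv_geomTorsion W p (k + 1) k.succ_pos hpQ'
    obtain ⟨ρ, hρ⟩ := exists_rep_of_addEquiv W e
    haveI : NeZero (p ^ (k + 1)) := ⟨pow_ne_zero _ hp.ne_zero⟩
    -- the matrix of `σ - 1`
    set M : Matrix (Fin 2) (Fin 2) (ZMod (p ^ (k + 1))) :=
      ((ρ σ : GL (Fin 2) (ZMod (p ^ (k + 1)))) : Matrix (Fin 2) (Fin 2) (ZMod (p ^ (k + 1))))
      with hM
    have hN : ∀ P : geomTorsion W ((p ^ (k + 1) : ℕ) : ℤ), e (σ • P - P) = (M - 1) *ᵥ e P := by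
      intro P
      rw [map_sub, hρ σ P, sub_mulVec, one_mulVec]
    -- `(σ - 1)² = 0`
    have hsq : (M - 1) * (M - 1) = 0 := by
      have hv : ∀ v : Fin 2 → ZMod (p ^ (k + 1)), ((M - 1) * (M - 1)) *ᵥ v = 0 := by
        intro v
        obtain ⟨P, rfl⟩ : ∃ P, e P = v := ⟨e.symm v, e.apply_symm_apply v⟩
        rw [← mulVec_mulVec, ← hN, ← hN, hU P, sub_self, map_zero]
      ext i j
      have := congrFun (hv (Pi.single j 1)) i
      rwa [mulVec_single_one] at this
    -- `σ ≢ 1 (mod p)`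
    have hne : (M - 1).map (ZMod.castHom (dvd_pow_self p k.succ_ne_zero) (ZMod p)) ≠ 0 := by
      intro h0
      obtain ⟨C, hC⟩ := GaloisRepresentations.Serre1968.exists_eq_add_smul_of_map_eq
        k.succ_ne_zero (M - 1) 0 (by rw [h0, Matrix.map_zero _ (map_zero _)])
      rw [zero_add] at hC
      apply hσQ
      have h1 : e (σ • Q - Q) = 0 := by
        rw [hN, hC, smul_mulVec, ← mulVec_smul, Nat.cast_smul_eq_nsmul, ← map_nsmul, hpQ,
          map_zero, mulVec_zero]
      exact sub_eq_zero.mp (e.injective (h1.trans (map_zero e).symm))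
    -- the image of `ρ` is everything
    have htop : ρ.range = ⊤ := by
      refine GaloisRepresentations.TransvectionLifting.generalLinearGroup_eq_top_of_unipotent_mem
        k.succ_ne_zero ρ.range (fun t ↦ ?_) ⟨ρ σ, ⟨σ, rfl⟩, hsq, hne⟩ (fun u ↦ ?_)
      · obtain ⟨τ, hτ⟩ := exists_map_eq_of_hasSurjectiveModNGaloisRep W p k hpQ' e ρ hρ hsurj t
        exact ⟨ρ τ, ⟨τ, rfl⟩, hτ⟩
      · obtain ⟨τ, hτ⟩ :=
          GaloisRepresentations.modNCyclotomicCharacter_rat_surjective (p ^ (k + 1)) u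
        refine ⟨ρ τ, ⟨τ, rfl⟩, Units.ext ?_⟩
        rw [Matrix.GeneralLinearGroup.val_det_apply, ← hτ]
        exact det_eq_modNCyclotomicCharacter W (p ^ (k + 1))
          (hp.two_le.trans (Nat.le_self_pow k.succ_ne_zero p)) e τ _ (hρ τ)
    -- every additive automorphism of `E[p^(k+1)]` has an invertible matrix, hence is some `τ`
    intro y
    obtain ⟨Φ, hΦ⟩ := exists_matrix_of_addEquiv e
    obtain ⟨B, hB⟩ := exists_generalLinearGroup_of_addEquiv Φ (Multiplicative.toAdd y)
    obtain ⟨τ, hτ⟩ : B ∈ ρ.range := htop ▸ Subgroup.mem_top B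
    refine ⟨τ, Multiplicative.toAdd.injective (AddEquiv.ext fun P ↦ e.injective ?_)⟩
    rw [galoisRepTorsion_apply, hρ τ P, hτ, hB]
    exact (hΦ _ P).symm

end Literature.NumberTheory.EllipticCurves

end
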